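import Summits.Ventures.CertifiedArithmetic.LowPrec.GemmThetaLawGenDefs

/-!
# Letter-dependent symbolic θ-certificates: the semantic objects (states, potential, alphabet)

HONEST FRAMING (venture CertifiedArithmetic / cell `pub-lowprec`, seat gemm, gen 12 → 13): certified
error envelopes and provably optimal rounding/accumulation schemes for low-precision formats under
stated cost models; every table by two implementations; no hardware or vendor claims.

Step (S2, first half) of the soundness chain for `GemmThetaLawGenDefs.lean` (cell HANDOFF decision
35; specification `code/gemm/thetalaw/GENDEFS-CONTRACT.md`).  For a law `L : LawData` and a
precision `m = p - 1` (`M = 2^m`), in GRID UNITS (`u = 2^-G`): the potential `L.psiZ m V` of a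
signed integer value `V` (the magnitude on the negative side and on the exact region `|V| < 2M`;
`B_j M + S_j ⌈t/2⌉` at the vertex `(M + t)·2^(j+1)` of a regular binade `j < J`, `B_J M + S_J t` on
the full binade, `(B_J + S_J) M` above), the state set `L.stZ m`, the continuity condition
`L.contOK` (`B_0 = 2`, `2B_{j+1} = 2B_j + S_j`: the closed form of binade `j` at `t = M` is that
of binade `j + 1` at `t = 0`), the vertex formula `psiZ_vertex'` for `0 ≤ t ≤ M` (top included),
and the rational-side objects `PiL` (alphabet), `SL` (states), `psiL` (potential) on the grid
`2^-G`.  Generalises `psiZp`/`stZ`/`psi_glue`/`psiZp_vertex'` of `GemmThetaLawE2M1Sound.lean` and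
`SP`/`psiP`/`piE2M1` of `GemmThetaLawE2M1.lean` from E2M1's tables to any `LawData`.
-/

namespace Literature.ComputerArithmetic.FloatingPoint

namespace MiniFloat

namespace ThetaLaw

namespace LawData

variable (L : LawData)

/-! ### The potential and the state set on integer values -/

/-- CONTINUITY OF THE CLAIMED ψ across level boundaries: `B_0 = 2` (`ψ_Q(2M) = 2M = B_0 M`) and
`2B_{j+1} = 2B_j + S_j` for `j < J` (`B_j M + S_j M/2 = B_{j+1} M`). Holds for all six laws of the
cell's `laws.py`; decided per law. [cell] -/
def contOK : Bool :=
  (L.Bj 0 == 2) && (List.range L.J).all fun j => 2 * L.Bj (j + 1) == 2 * L.Bj j + L.Sj j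

/-- The closed form of the potential at the vertex `(M + t)·2^(j+1)` (integer `t`; `j = J + 1` is
the top). [cell, gemm.tex t:thetap6 / t:thetapmix] -/
def psiBin (M : ℤ) (j : ℕ) (t : ℤ) : ℤ :=
  if j < L.J then L.Bj j * M + L.Sj j * ((t + 1) / 2)
  else if j = L.J then L.Bj j * M + L.Sj j * t
  else (L.Bj L.J + L.Sj L.J) * M

/-- THE POTENTIAL (grid units) at a signed value `V` for precision `m = p - 1`: `|V|` on the
negative side and on the exact region `V < 2^(m+1)`; the binade closed form `psiBin` above.
[cell, gemm.tex t:thetap6 / t:thetapmix (ii)] -/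
def psiZ (m : ℕ) (V : ℤ) : ℤ :=
  if V < 0 then -V
  else if V < 2 ^ (m + 1) then V
  else
    let n := V.toNat
    let e := Nat.log2 n - m
    let t := n / 2 ^ e - 2 ^ m
    L.psiBin (2 ^ m) (e - 1) (t : ℤ)

/-- THE STATE SET (grid units): `|V| < 2^(m+1)`, or `|V| = (M + t)·2^(j+1)` with `j ≤ J`, `t ≤ M`
(`t = M` is the first vertex of the next binade; `j = J, t = M` is the top). [cell] -/
def stZ (m : ℕ) (V : ℤ) : Prop :=
  V.natAbs < 2 ^ (m + 1) ∨ ∃ j t : ℕ, j ≤ L.J ∧ t ≤ 2 ^ m ∧ V.natAbs = (2 ^ m + t) * 2 ^ (j + 1)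

/-- On the negative side the potential is the magnitude. [cell] -/
theorem psiZ_of_neg (m : ℕ) {V : ℤ} (h : V < 0) : L.psiZ m V = -V := by
  unfold psiZ; rw [if_pos h]

/-- On the exact region the potential is the value. [cell] -/
theorem psiZ_of_small (m : ℕ) {V : ℤ} (h0 : 0 ≤ V) (h : V < 2 ^ (m + 1)) : L.psiZ m V = V := by
  unfold psiZ; rw [if_neg (by omega), if_pos h]

/-- `ψ(V) = |V|` whenever `|V| < 2^p`. [cell] -/
theorem psiZ_of_natAbs_lt (m : ℕ) {V : ℤ} (h : V.natAbs < 2 ^ (m + 1)) :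
    L.psiZ m V = (V.natAbs : ℤ) := by
  have h' : ((V.natAbs : ℕ) : ℤ) < (2 : ℤ) ^ (m + 1) := by exact_mod_cast h
  by_cases hV : V < 0
  · rw [L.psiZ_of_neg m hV]; omega
  · rw [L.psiZ_of_small m (by omega) (by omega)]; omega

/-- `ψ(-W) = W` for `W ≥ 0`. [cell] -/
theorem psiZ_neg_of_nonneg (m : ℕ) {W : ℤ} (h : 0 ≤ W) : L.psiZ m (-W) = W := by
  rcases eq_or_lt_of_le h with rfl | h'
  · simp [psiZ]
  · rw [L.psiZ_of_neg m (by omega)]; ring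

/-- THE POTENTIAL AT A VERTEX `(M + t)·u_j`, `t < M`, any `j` (for `j > J` the top value).
[cell] -/
theorem psiZ_vertex {m : ℕ} {j t : ℕ} (ht : t < 2 ^ m) :
    L.psiZ m ((((2 ^ m + t) * 2 ^ (j + 1) : ℕ) : ℤ)) = L.psiBin (2 ^ m) j (t : ℤ) := by
  have hn0 : (2 ^ m + t) * 2 ^ (j + 1) ≠ 0 := by positivity
  have hlo : 2 ^ (m + j + 1) ≤ (2 ^ m + t) * 2 ^ (j + 1) := by
    rw [show m + j + 1 = m + (j + 1) by omega, pow_add]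
    exact Nat.mul_le_mul_right _ (Nat.le_add_right _ _)
  have hhi : (2 ^ m + t) * 2 ^ (j + 1) < 2 ^ (m + j + 1 + 1) := by
    have h1 : 2 ^ m + t < 2 ^ (m + 1) := by rw [pow_succ]; omega
    calc (2 ^ m + t) * 2 ^ (j + 1) < 2 ^ (m + 1) * 2 ^ (j + 1) :=
          Nat.mul_lt_mul_of_pos_right h1 (by positivity)
      _ = 2 ^ (m + j + 1 + 1) := by rw [← pow_add, show m + 1 + (j + 1) = m + j + 1 + 1 by omega]
  have hlog : Nat.log2 ((2 ^ m + t) * 2 ^ (j + 1)) = m + j + 1 :=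
    (Nat.log2_eq_iff hn0).mpr ⟨hlo, hhi⟩
  have hge : ¬ ((((2 ^ m + t) * 2 ^ (j + 1) : ℕ) : ℤ)) < 2 ^ (m + 1) := by
    rw [not_lt]
    have : 2 ^ (m + 1) ≤ (2 ^ m + t) * 2 ^ (j + 1) :=
      le_trans (Nat.pow_le_pow_right (by norm_num) (by omega)) hlo
    exact_mod_cast this
  have he : m + j + 1 - m = j + 1 := by omega
  unfold psiZ
  rw [if_neg (not_lt.mpr (by positivity)), if_neg hge]
  simp only [Int.toNat_natCast, hlog, he, Nat.mul_div_cancel _ (show 0 < 2 ^ (j + 1) by positivity),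
    Nat.add_sub_cancel_left, Nat.add_sub_cancel]

/-- The continuity identities, unpacked. [cell] -/
theorem contOK_spec (h : L.contOK = true) :
    L.Bj 0 = 2 ∧ ∀ j, j < L.J → 2 * L.Bj (j + 1) = 2 * L.Bj j + L.Sj j := by
  unfold contOK at h
  simp only [Bool.and_eq_true, beq_iff_eq, List.all_eq_true, List.mem_range] at h
  exact ⟨h.1, h.2⟩

/-- THE GLUING OF CONSECUTIVE LEVELS: the closed form of binade `j ≤ J` at `t = M = 2H` is the
closed form of level `j + 1` at `t = 0`. [cell] -/
theorem psi_glue (h : L.contOK = true) {j : ℕ} (hj : j ≤ L.J) (H : ℤ) :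
    L.psiBin (2 * H) (j + 1) 0 = L.psiBin (2 * H) j (2 * H) := by
  obtain ⟨-, hc⟩ := L.contOK_spec h
  have h2 : (2 * H + 1) / 2 = H := by omega
  unfold psiBin
  rcases Nat.lt_or_eq_of_le hj with hlt | rfl
  · have hcj := hc j hlt
    by_cases h1 : j + 1 < L.J
    · rw [if_pos h1, if_pos hlt, h2]
      have h0 : ((0 : ℤ) + 1) / 2 = 0 := by decide
      rw [h0]; linear_combination H * hcj
    · rw [if_neg h1, if_pos (show j + 1 = L.J by omega), if_pos hlt, h2]
      linear_combination H * hcj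
  · rw [if_neg (by omega), if_neg (by omega), if_neg (lt_irrefl _), if_pos rfl]; ring

/-- THE POTENTIAL AT `(M + t)·u_j` FOR `0 ≤ t ≤ M` (integer `t`, `M = 2H = 2^m`, `j ≤ J + 1`),
top included (`j = J + 1` forces `t = 0`). [cell] -/
theorem psiZ_vertex' (hc : L.contOK = true) {m : ℕ} {H : ℤ} (hM : (2 : ℤ) ^ m = 2 * H) {j : ℕ}
    (hj : j ≤ L.J + 1) {t : ℤ} (ht0 : 0 ≤ t) (ht : t ≤ 2 * H) (htop : j = L.J + 1 → t = 0) :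
    L.psiZ m ((2 * H + t) * 2 ^ (j + 1)) = L.psiBin (2 * H) j t := by
  rcases lt_or_eq_of_le ht with hlt | rfl
  · -- interior vertex
    have htn : ((t.toNat : ℕ) : ℤ) = t := Int.toNat_of_nonneg ht0
    have htn' : t.toNat < 2 ^ m := by
      have : ((t.toNat : ℕ) : ℤ) < ((2 ^ m : ℕ) : ℤ) := by push_cast; rw [htn, hM]; exact hlt
      exact_mod_cast this
    have hv : (2 * H + t) * 2 ^ (j + 1) = (((2 ^ m + t.toNat) * 2 ^ (j + 1) : ℕ) : ℤ) := by
      push_cast; rw [htn, hM]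
    rw [hv, L.psiZ_vertex htn', htn, hM]
  · -- `t = M`: the first vertex of level `j + 1`
    have hjJ : j ≤ L.J := by
      by_contra h'
      have := htop (by omega)
      have : (0 : ℤ) < 2 * H := by rw [← hM]; positivity
      omega
    have hv : (2 * H + 2 * H) * (2 : ℤ) ^ (j + 1) = (((2 ^ m + 0) * 2 ^ ((j + 1) + 1) : ℕ) : ℤ) := by
      push_cast; rw [hM]; ring
    rw [hv, L.psiZ_vertex (by positivity)]
    push_cast; rw [hM]
    exact L.psi_glue hc hjJ H

/-- A state on the exact region or at a vertex is in `stZ`. [cell] -/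
theorem stZ_of_vertex {m : ℕ} {j t : ℕ} (hj : j ≤ L.J) (ht : t ≤ 2 ^ m) {V : ℤ}
    (hV : V.natAbs = (2 ^ m + t) * 2 ^ (j + 1)) : L.stZ m V :=
  Or.inr ⟨j, t, hj, ht, hV⟩

/-! ### The rational side: alphabet, states and potential on the grid `2^-G` -/

/-- The signed product alphabet as values: `z·2^-G`, `z ∈ Λ = {0} ∪ X ∪ -X`. [cell] -/
def PiL (G : ℕ) (q : ℚ) : Prop := ∃ z ∈ L.lam, q = (z : ℚ) / 2 ^ G

/-- The state predicate on values: a grid point of `stZ φ.manBits`. [cell] -/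
def SL (G : ℕ) (φ : Format) (v : ℚ) : Prop := ∃ V : ℤ, L.stZ φ.manBits V ∧ v = (V : ℚ) / 2 ^ G

/-- The potential on values (grid units inside). [cell] -/
def psiL (G : ℕ) (φ : Format) (v : ℚ) : ℚ := (L.psiZ φ.manBits ⌊v * 2 ^ G⌋ : ℚ) / 2 ^ G

/-- `ψ` on the grid. [folklore] -/
theorem psiL_grid (G : ℕ) (φ : Format) (V : ℤ) :
    L.psiL G φ ((V : ℚ) / 2 ^ G) = (L.psiZ φ.manBits V : ℚ) / 2 ^ G := by
  unfold psiL
  rw [div_mul_cancel₀ (V : ℚ) (by positivity : (2 : ℚ) ^ G ≠ 0), Int.floor_intCast]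

/-- `θ = (th1·M + th0)/thD` at precision `m` (`M = 2^m`). [cell] -/
def thetaL (m : ℕ) : ℚ := (L.th1 * 2 ^ m + L.th0 : ℚ) / L.thD

/-- `κ = 2^kb/(B_kb·M + S_kb)`. [cell] -/
def kappaL (m : ℕ) : ℚ := (2 : ℚ) ^ L.kb / (L.Bj L.kb * 2 ^ m + L.Sj L.kb)

/-- `ρ`. [cell] -/
def rhoL : ℚ := (L.rhoN : ℚ) / L.rhoD

/-- `β_pair`. [cell] -/
def betaL : ℚ := (L.betaN : ℚ) / L.betaD

end LawData

/-! ### Sanity values (E2M1-shaped data) -/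

/-- A two-binade toy law (`J = 1`, `B = (2,3)`, `S = (2,4)`) for the sanity checks below. [cell] -/
def toyLaw : LawData :=
  { X := [1, 2], J := 1, B := [2, 3], S := [2, 4], th1 := 1, th0 := 0, thD := 1, kb := 0,
    rhoN := 1, rhoD := 1, betaN := 1, betaD := 1, M0 := 8, K0 := 2, fixed := false }

/-- `contOK` holds for the toy law (`2·3 = 2·2 + 2`); with `m = 4` (`M = 16`): `ψ(-5) = 5`,
`ψ(31) = 31` (exact region), `ψ(34) = ψ((16+1)·2) = 2·16 + 2·1 = 34`, `ψ(36) = 34` (even `t = 2`: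
`⌈2/2⌉ = 1`), `ψ(64) = ψ((16+0)·4) = B_1·16 = 48`, `ψ(68) = 48 + 4 = 52` (full binade, `S_1 t`),
top `ψ(128) = (3+4)·16 = 112`. [cell, kernel-checked] -/
theorem toyLaw_values :
    toyLaw.contOK = true ∧ toyLaw.psiZ 4 (-5) = 5 ∧ toyLaw.psiZ 4 31 = 31 ∧ toyLaw.psiZ 4 34 = 34 ∧
      toyLaw.psiZ 4 36 = 34 ∧ toyLaw.psiZ 4 64 = 48 ∧ toyLaw.psiZ 4 68 = 52 ∧
      toyLaw.psiZ 4 128 = 112 := by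
  decide +kernel

end ThetaLaw

end MiniFloat

end Literature.ComputerArithmetic.FloatingPoint
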